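/-
Copyright (c) 2026 the pub-hodgecm-mathlib formalisation cell (harness21).  Prover seat hodgecm-mathlib-LH1-p01 (g11): LH4 price-list item (P2d) «the nhds-basis CONSUMER,
de-`h2`'d» (dealer LH4-plan (g6) WORD #54), 2026-09-02.  Over ★ `UnitaryCarrierCongruenceNhdsBasis` (N5b) and ★ p851712 `MatrixMoebiusShiftLevelDyadic`.
-/
import Literature.NumberTheory.Automorphic.UnitaryCarrierCongruenceNhdsBasis   -- ★ N5b: `exists_level_forall_prod_mem_of_mem_nhds_one` (congruence boxes ⊂ every `V′ ∈ 𝓝 1`), the `h2` head `exists_level_forall_shift_mem_of_mem_nhds_one` this file supersedes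
import Literature.NumberTheory.Automorphic.MatrixMoebiusShiftLevelDyadic      -- ★ p851712: `valued_moebius_sub_one_le_of_level_of_exp`, `valued_moebius_scalar_sub_one_le_of_level_of_exp` (the level drop WITHOUT `|2| = 1`, `j ≥ ord 2 + 1`)
import HarnessLib

/-!
# «`u_H → 1` as `γ_H → 1`» for the Cayley shift at ANY residue characteristic: the `|2|_w = 1` binder of N5b deleted

Topic `NumberTheory/Automorphic`; namespace `Literature.NumberTheory.Automorphic` (= ★ `UnitaryCarrierCongruenceNhdsBasis`'s).  THEOREMS ONLY (no definition, no instance, no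
notation, no named fact, no `sorry`); kernel lane `--supports stmt-HodgeConjecture-24833`, count-neutral.  Cell `pub/hodgecm-mathlib` (D-0151), crux H413 =
`stmt-HodgeConjecture-24833`, half A line LH4, price-list item (P2d) of LH4-plan (g6) WORD #54 (p06 census row M5): the nhds-basis CONSUMER ★
`exists_level_forall_shift_mem_of_mem_nhds_one (w) (hw) (hc : |c_w| = exp(−1)) (h2 : |2|_w = 1) (hV′)` of organ (I) (N5b; consumers ★ `Rogawski1990/LevelTwoLiftInterior{,Adapters}`)
with the binder `h2` DELETED — statement otherwise byte-identical — so this head SUPERSEDES ★'s (★'s file is not touched).  HONEST LABEL: HC_CM is proved only modulo the 7 printed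
citations (2 remaining named inputs: hLiu418 = stmt-HodgeConjecture-24832, h413 = stmt-HodgeConjecture-24833) until rung 0 closes; count-neutral (pays no organ, opens no road).

THE MATHEMATICS.  The conclusion is an «`∃ j ≥ 1`» statement, so only DEEP levels are needed, and deep levels need no hypothesis on `|2|`: `L_w` has characteristic `0`, so
`|2|_w = exp(−e)` for SOME `e : ℕ` (§0, `2 ∈ 𝓞`); take `j := max j₀ (e + 1)` where `j₀` is the level of the congruence box inside `V′` (★ `exists_level_forall_prod_mem_of_mem_nhds_one`)
and use the dyadic level drop ★ p851712 (`j ≥ e + 1`: `g ≡ 1 (mod c^{j+1})` ⇒ `φ_c(g) ≡ 1 (mod c^j)`, matrix and scalar) in place of ★ N5a; a level-`j` congruence implies the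
level-`j₀` one (`|c| ≤ 1`).  The `IsUnit` denominators of the statement are HYPOTHESES of the universal clause, exactly as in ★, so no dominance is needed for them.

## References
* [Rogawski1990] J. Rogawski, *Automorphic Representations of Unitary Groups in Three Variables*, Ann. of Math. Stud. 123 (1990), §4.9 Prop. 4.9.1 p. 55.
* [Kottwitz1986] R. Kottwitz, *Base change for unit elements of Hecke algebras*, Compositio Math. 60 (1986), §3.
* [BernsteinZelevinsky1976] I. N. Bernstein, A. V. Zelevinsky, *Representations of the group GL(n,F) where F is a non-archimedean local field*, Russian Math. Surveys 31 (1976), §1.1.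
* [Omeara1963] O. T. O'Meara, *Introduction to Quadratic Forms* (1963), §63.
-/

set_option autoImplicit false

noncomputable section

open NumberField IsDedekindDomain Matrix ValuativeRel Topology Filter Set
open Literature.NumberTheory.Automorphic.UnitaryGroup Literature.NumberTheory.Automorphic.UnitaryLatticeTree
open Literature.NumberTheory.Automorphic.HermitianLattice Literature.NumberTheory.Automorphic.MoebiusShift
open Literature.NumberTheory.Rogawski1990 Literature.NumberTheory.GaloisRepresentations
open scoped Matrix MatrixGroups ValuativeRel

namespace Literature.NumberTheory.Automorphic

/-! ## §0 `|2|_w = exp(−e)` for some `e : ℕ` (characteristic zero, `2 ∈ 𝓞`) -/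

section Two

variable (K : Type) [Field K] [NumberField K] (u : HeightOneSpectrum (𝓞 K))

/-- **`|2|_u = exp(−e)` for some `e : ℕ`** in the completion of a number field at a finite place (`2 ≠ 0` and `2 ∈ 𝓞_K`): the «`e = ord_u 2`» the dyadic bricks are dressed in.
[cite: Omeara1963, §63] -/
theorem exists_valued_two_eq_exp_neg : ∃ e : ℕ, Valued.v (2 : u.adicCompletion K) = WithZero.exp (-(e : ℤ)) := by
  have hcast : (2 : u.adicCompletion K) = algebraMap K (u.adicCompletion K) (algebraMap (𝓞 K) K (2 : 𝓞 K)) := by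
    rw [map_ofNat, map_ofNat]
  have hval : ∀ c : K, Valued.v (algebraMap K (u.adicCompletion K) c) = u.valuation K c :=
    fun c => HeightOneSpectrum.valuedAdicCompletion_eq_valuation' u c
  have hle : Valued.v (2 : u.adicCompletion K) ≤ 1 := by
    rw [hcast, hval, HeightOneSpectrum.valuation_of_algebraMap]
    exact u.intValuation_le_one _
  have hne : Valued.v (2 : u.adicCompletion K) ≠ 0 := by
    rw [Valuation.ne_zero_iff, hcast, map_ofNat]
    exact (_root_.map_ne_zero (algebraMap K (u.adicCompletion K))).2 two_ne_zero
  obtain ⟨m, hm⟩ : ∃ m : ℤ, Valued.v (2 : u.adicCompletion K) = WithZero.exp m := ⟨_, (WithZero.exp_log hne).symm⟩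
  have hm0 : m ≤ 0 := by rw [hm, ← WithZero.exp_zero, WithZero.exp_le_exp] at hle; exact hle
  refine ⟨(-m).toNat, ?_⟩
  rw [hm, Int.toNat_of_nonneg (by omega), neg_neg]

end Two

/-! ## §1 N5b without `|2|_w = 1` -/

section CarrierNhds

variable (L : Type) [Field L] [NumberField L] [IsCMField L]

set_option maxHeartbeats 800000 in
-- budget only: one statement-heavy declaration (the (A3) shift binders); no search tactic runs long here.
/-- **«`u_H → 1` as `γ_H → 1`» for the Cayley shift, ANY residue characteristic** (organ (I), N5b de-`h2`'d — SUPERSEDES ★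
`exists_level_forall_shift_mem_of_mem_nhds_one`, whose statement this is with the binder `(h2 : |2|_w = 1)` deleted): given `V′ ∈ 𝓝 1` in the endoscopic carrier there is
`j ≥ 1` such that every pair `(γ_H, u_H)` with `u_H = φ_c(γ_H)` componentwise (the (A3) binders, denominators invertible) and `γ_H ≡ 1 (mod c_w^{j+1})` at `w` has `u_H ∈ V′`.
Proof: `|2|_w = exp(−e)` (§0); `j := max j₀ (e+1)` with `j₀` from ★ `exists_level_forall_prod_mem_of_mem_nhds_one`; the shift loses one level by ★ p851712 (`j ≥ e + 1`).
[cite: Rogawski1990, §4.9 Prop. 4.9.1 p. 55] [cite: Kottwitz1986, §3] [cite: Omeara1963, §63] -/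
theorem exists_level_forall_shift_mem_of_mem_nhds_one_dyadic
    {v : HeightOneSpectrum (𝓞 ↥(maximalRealSubfield L))}
    (w : UnitaryGroup.PlacesOver L v) (hw : IsCMField.complexConj L • w.1 = w.1)
    {c : LocalRing L v} (hc : Valued.v (c w) = WithZero.exp (-1 : ℤ))
    {V' : Set (((cmDatum L 2 (Matrix.of fun i j : Fin 2 => if i.val + j.val + 1 = 2 then (1 : L) else 0)).Local v) × ((cmDatum L 1 (Matrix.of fun i j : Fin 1 => if i.val + j.val + 1 = 1 then (1 : L) else 0)).Local v))} (hV' : V' ∈ 𝓝 (1 : (((cmDatum L 2 (Matrix.of fun i j : Fin 2 => if i.val + j.val + 1 = 2 then (1 : L) else 0)).Local v) × ((cmDatum L 1 (Matrix.of fun i j : Fin 1 => if i.val + j.val + 1 = 1 then (1 : L) else 0)).Local v)))) :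
    ∃ j : ℕ, 1 ≤ j ∧ ∀ γH uH : (((cmDatum L 2 (Matrix.of fun i j : Fin 2 => if i.val + j.val + 1 = 2 then (1 : L) else 0)).Local v) × ((cmDatum L 1 (Matrix.of fun i j : Fin 1 => if i.val + j.val + 1 = 1 then (1 : L) else 0)).Local v)),
      (∀ i k, Valued.v (((((γH.1.val : GL (Fin 2) (LocalRing L v)).val : Matrix (Fin 2) (Fin 2) (LocalRing L v))).map (Pi.evalRingHom (fun w' : UnitaryGroup.PlacesOver L v => w'.1.adicCompletion L) w) - 1) i k) ≤ Valued.v (c w) ^ (j + 1)) →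
      Valued.v (finGammaTwo L v γH w - 1) ≤ Valued.v (c w) ^ (j + 1) →
      IsUnit ((c - 1) • ((γH.1.val : GL (Fin 2) (LocalRing L v)).val : Matrix (Fin 2) (Fin 2) (LocalRing L v)) + (c + 1) • (1 : Matrix (Fin 2) (Fin 2) (LocalRing L v))).det →
      IsUnit ((c - 1) * finGammaTwo L v γH + (c + 1)) →
      ((uH.1.val : GL (Fin 2) (LocalRing L v)).val : Matrix (Fin 2) (Fin 2) (LocalRing L v)) =
        ((c + 1) • ((γH.1.val : GL (Fin 2) (LocalRing L v)).val : Matrix (Fin 2) (Fin 2) (LocalRing L v)) + (c - 1) • 1) *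
          ((c - 1) • ((γH.1.val : GL (Fin 2) (LocalRing L v)).val : Matrix (Fin 2) (Fin 2) (LocalRing L v)) + (c + 1) • 1)⁻¹ →
      finGammaTwo L v uH = ((c + 1) * finGammaTwo L v γH + (c - 1)) * Ring.inverse ((c - 1) * finGammaTwo L v γH + (c + 1)) →
      uH ∈ V' := by
  classical
  have hc0 : c w ≠ 0 := fun h => by rw [h, map_zero] at hc; exact WithZero.zero_ne_coe hc
  have hc1' : Valued.v (c w) < 1 := by
    rw [hc, ← WithZero.exp_zero]; exact WithZero.exp_lt_exp.2 (by norm_num)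
  obtain ⟨j₀, hj₀, hV⟩ := exists_level_forall_prod_mem_of_mem_nhds_one L w hw hc0 hc1' hV'
  obtain ⟨e, he⟩ := exists_valued_two_eq_exp_neg L w.1
  -- deeper than the box AND deeper than `ord 2`: `j := max j₀ (e + 1)`
  have hje : e + 1 ≤ max j₀ (e + 1) := le_max_right _ _
  have hj0 : j₀ ≤ max j₀ (e + 1) := le_max_left _ _
  -- a level-`j` congruence implies the level-`j₀` one
  have hmono : ∀ (M : ℕ) (A : Matrix (Fin M) (Fin M) (w.1.adicCompletion L)),
      (∀ a b, Valued.v (A a b) ≤ Valued.v (c w) ^ max j₀ (e + 1)) → IsIntMatrix ((c w ^ j₀)⁻¹ • A) := fun M A hA => by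
    refine (isIntMatrix_inv_smul_iff (pow_ne_zero _ hc0) A).2 fun a b => (hA a b).trans ?_
    rw [Valuation.map_pow]
    exact pow_le_pow_right_of_le_one' hc1'.le hj0
  refine ⟨max j₀ (e + 1), hj₀.trans hj0, fun γH uH hg hu hD hU h1 hu' => hV uH ?_ ?_⟩
  · -- the `U(Φ₂)`-component: `(u_H.1)_w = φ_{c_w}(g_w)` loses one level (★ p851712, `j ≥ e + 1`)
    have hmat : ((((localNonsplitEquiv (IsCMField.complexConj L) (Matrix.of fun i j : Fin 2 => if i.val + j.val + 1 = 2 then (1 : L) else 0) (IsCMField.complexConj_ne_one L) w hw uH.1) : ↥(unitaryGroupOfForm (galAdicCompletionMap (L := L) (IsCMField.complexConj L) hw) (placeForm (Matrix.of fun i j : Fin 2 => if i.val + j.val + 1 = 2 then (1 : L) else 0) w.1))) : GL (Fin 2) (w.1.adicCompletion L)) : Matrix (Fin 2) (Fin 2) (w.1.adicCompletion L)) =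
        ((c w + 1) • (((γH.1.val : GL (Fin 2) (LocalRing L v)).val : Matrix (Fin 2) (Fin 2) (LocalRing L v))).map (Pi.evalRingHom (fun w' : UnitaryGroup.PlacesOver L v => w'.1.adicCompletion L) w) + (c w - 1) • (1 : Matrix (Fin 2) (Fin 2) (w.1.adicCompletion L))) *
          ((c w - 1) • (((γH.1.val : GL (Fin 2) (LocalRing L v)).val : Matrix (Fin 2) (Fin 2) (LocalRing L v))).map (Pi.evalRingHom (fun w' : UnitaryGroup.PlacesOver L v => w'.1.adicCompletion L) w) + (c w + 1) • (1 : Matrix (Fin 2) (Fin 2) (w.1.adicCompletion L)))⁻¹ := by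
      rw [coe_localNonsplitEquiv_apply L (Matrix.of fun i j : Fin 2 => if i.val + j.val + 1 = 2 then (1 : L) else 0) v w hw uH.1]
      show (((uH.1.val : GL (Fin 2) (LocalRing L v)).val : Matrix (Fin 2) (Fin 2) (LocalRing L v))).map (Pi.evalRingHom (fun w' : UnitaryGroup.PlacesOver L v => w'.1.adicCompletion L) w) = _
      rw [h1, map_moebius (Pi.evalRingHom (fun w' : UnitaryGroup.PlacesOver L v => w'.1.adicCompletion L) w) _ _ _ hD, map_add, map_sub, map_one]
      rfl
    have hlev := (valued_moebius_sub_one_le_of_level_of_exp hc he ((((γH.1.val : GL (Fin 2) (LocalRing L v)).val : Matrix (Fin 2) (Fin 2) (LocalRing L v))).map (Pi.evalRingHom (fun w' : UnitaryGroup.PlacesOver L v => w'.1.adicCompletion L) w)) hje hg).1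
    refine hmono _ _ fun a b => ?_
    rw [hmat]
    exact hlev a b
  · -- the `U(Φ₁)`-component: the entry `γ₂(u_H)_w = φ_{c_w}(γ₂(γ_H)_w)`
    have hmul : finGammaTwo L v uH * ((c - 1) * finGammaTwo L v γH + (c + 1)) = (c + 1) * finGammaTwo L v γH + (c - 1) := by
      rw [hu', mul_assoc, Ring.inverse_mul_cancel _ hU, mul_one]
    have hw' : finGammaTwo L v uH w * ((c w - 1) * finGammaTwo L v γH w + (c w + 1)) =
        (c w + 1) * finGammaTwo L v γH w + (c w - 1) := by
      have h := congrArg (fun f : LocalRing L v => f w) hmul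
      simpa only [Pi.mul_apply, Pi.add_apply, Pi.sub_apply, Pi.one_apply] using h
    have hden : (c w - 1) * finGammaTwo L v γH w + (c w + 1) ≠ 0 := by
      obtain ⟨u, hu0⟩ := hU
      intro h0
      have h1' : ((u : LocalRing L v) w) * (((u⁻¹ : (LocalRing L v)ˣ) : LocalRing L v) w) = 1 := by
        have h := congrArg (fun f : LocalRing L v => f w) u.mul_inv
        simpa only [Pi.mul_apply, Pi.one_apply] using h
      have hcw : (u : LocalRing L v) w = (c w - 1) * finGammaTwo L v γH w + (c w + 1) := by
        rw [hu0]; simp only [Pi.mul_apply, Pi.add_apply, Pi.sub_apply, Pi.one_apply]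
      rw [hcw, h0, zero_mul] at h1'
      exact zero_ne_one h1'
    have huw : finGammaTwo L v uH w =
        ((c w + 1) * finGammaTwo L v γH w + (c w - 1)) / ((c w - 1) * finGammaTwo L v γH w + (c w + 1)) := by
      rw [eq_div_iff hden]; exact hw'
    have hlev := (valued_moebius_scalar_sub_one_le_of_level_of_exp hc he (finGammaTwo L v γH w) hje hu).1
    refine hmono _ _ fun a b => ?_
    have ha : a = 0 := Subsingleton.elim _ _
    have hb : b = 0 := Subsingleton.elim _ _
    subst ha; subst hb
    rw [Matrix.sub_apply, coe_localNonsplitEquiv_apply L (Matrix.of fun i j : Fin 1 => if i.val + j.val + 1 = 1 then (1 : L) else 0) v w hw uH.2, Matrix.one_apply_eq]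
    show Valued.v (finGammaTwo L v uH w - 1) ≤ _
    rw [huw]; exact hlev

end CarrierNhds

end Literature.NumberTheory.Automorphic

end
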